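import Mathlib
import Summits.Ventures.DiscreteObjects.Mahler.MahlerMeasureIntegral
import Summits.Ventures.DiscreteObjects.Mahler.SubLehmerDegree57

/-!
# `M(P)` is an algebraic unit when `P` is monic with `P(0) = ±1`; irreducible self-reciprocal polynomials
(venture `DiscreteObjects`, target L)

Cell `pub-namedobj`, seat `pub-namedobj-mahler` (gen 10). Framing: lottery ticket; floor = certified
bounds/negative ranges.

1. **Units.** For a monic `P ∈ ℤ[X]` with `P(0) = ±1` — in particular for every candidate of the
   small-measure census (reciprocal, monic) — the Mahler measure `M(P)` is a UNIT of the ring of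
   algebraic integers: both `M(P)` and `M(P)⁻¹` are algebraic integers.  Indeed `M(P) = |β|`,
   `β = ∏_{|α|>1} α`, and `β⁻¹ = ±∏_{|α|≤1} α` is again a sub-product of the roots, integral by
   `isIntegral_leadingCoeff_mul_prod_roots` ([McKee–Smyth, proof of Prop. 1.9]).
   `isIntegral_inv_intMahlerMeasure`, `intMahlerMeasure_unit`.
2. **[McKee–Smyth, Exercise A.5]** An irreducible `P ∈ ℤ[X]` with `P.reverse = ±P` is `±(X - 1)`,
   `±(X + 1)`, or palindromic (`P.reverse = P`) of even degree: `self_reciprocal_irreducible_classification`.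
-/

namespace Summit.Ventures.DiscreteObjects.Mahler

open Polynomial
open scoped ComplexConjugate

/-! ### `M(P)⁻¹` is an algebraic integer for monic `P` with `P(0) = ±1` -/

/-- For a monic `P ∈ ℤ[X]` with `P(0) = ±1`, `M(P)⁻¹` is an algebraic integer (so `M(P)` is a unit
in the ring of algebraic integers). -/
theorem isIntegral_inv_intMahlerMeasure {P : ℤ[X]} (hmonic : P.Monic) (h0 : P.coeff 0 = 1 ∨ P.coeff 0 = -1) :
    IsIntegral ℤ (intMahlerMeasure P)⁻¹ := by
  classical
  set R := (P.map (Int.castRingHom ℂ)).roots with hR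
  set S₂ := R.filter fun a => ¬ ‖a‖ ≤ 1 with hS₂
  set S₁ := R.filter fun a => ‖a‖ ≤ 1 with hS₁
  have hsplitR : S₁ + S₂ = R := Multiset.filter_add_not _ R
  -- `∏ R = ± 1` from `P(0) = ±1` and monicity
  have hPC : P.map (Int.castRingHom ℂ) = (R.map fun α => X - C α).prod := by
    have h := (IsAlgClosed.splits (P.map (Int.castRingHom ℂ))).eq_prod_roots_of_monic (hmonic.map _)
    rw [← hR] at h; exact h
  have hprodR : R.prod = 1 ∨ R.prod = -1 := by
    have h1 : ((P.coeff 0 : ℤ) : ℂ) = (R.map fun α => -α).prod := by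
      rw [← eq_intCast (Int.castRingHom ℂ), ← coeff_map, hPC, coeff_zero_multiset_prod, Multiset.map_map]
      exact congrArg _ (Multiset.map_congr rfl fun α _ => by simp)
    have h2 : (R.map fun α => -α).prod = (-1) ^ Multiset.card R * R.prod := by
      rw [← Multiset.prod_map_neg]
    rw [h2] at h1
    rcases h0 with h | h <;> rw [h] at h1 <;> push_cast at h1 <;>
      rcases neg_one_pow_eq_or ℂ (Multiset.card R) with h3 | h3 <;> rw [h3] at h1
    · left; linear_combination -h1
    · right; linear_combination h1
    · right; linear_combination -h1
    · left; linear_combination h1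
  -- `β = ∏ S₂`, `β⁻¹ = ± ∏ S₁`
  set β : ℂ := S₂.prod with hβ
  have hβS₁ : β * S₁.prod = 1 ∨ β * S₁.prod = -1 := by
    rw [hβ, mul_comm, ← Multiset.prod_add, hsplitR]; exact hprodR
  have hβ0 : β ≠ 0 := by
    intro h; rcases hβS₁ with h' | h' <;> rw [h, zero_mul] at h' <;> norm_num at h'
  have hS₁int : IsIntegral ℤ S₁.prod := by
    have h := isIntegral_leadingCoeff_mul_prod_roots P (T := S₁) (Multiset.filter_le _ _)
    rwa [hmonic.leadingCoeff, Int.cast_one, one_mul] at h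
  have hβinv : IsIntegral ℤ β⁻¹ := by
    rcases hβS₁ with h | h
    · have : β⁻¹ = S₁.prod := (eq_inv_of_mul_eq_one_right h).symm
      rw [this]; exact hS₁int
    · have : β⁻¹ = -S₁.prod := by
        have h' : β * (-S₁.prod) = 1 := by rw [mul_neg, h, neg_neg]
        exact (eq_inv_of_mul_eq_one_right h').symm
      rw [this]; exact hS₁int.neg
  -- `M(P) = ‖β‖`, `β` real
  have hM : intMahlerMeasure P = ‖β‖ := by
    rw [intMahlerMeasure_eq_norm_prod_roots hmonic]
  have hβconj : conj β = β := conj_prod_roots_outside P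
  have hβinv_real : (((β⁻¹).re : ℝ) : ℂ) = β⁻¹ :=
    Complex.conj_eq_iff_re.mp (by rw [map_inv₀, hβconj])
  have hre : IsIntegral ℤ (β⁻¹).re := by
    rw [← hβinv_real] at hβinv
    exact (isIntegral_algebraMap_iff (A := ℝ) (B := ℂ) (algebraMap ℝ ℂ).injective).mp hβinv
  have hMinv : (intMahlerMeasure P)⁻¹ = |(β⁻¹).re| := by
    rw [hM, ← norm_inv]
    conv_lhs => rw [← hβinv_real]
    rw [Complex.norm_real, Real.norm_eq_abs]
  rw [hMinv]
  rcases abs_choice (β⁻¹).re with h | h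
  · rw [h]; exact hre
  · rw [h]; exact hre.neg

/-- **`M(P)` is an algebraic unit** for monic `P ∈ ℤ[X]` with `P(0) = ±1`: `M(P)` and `M(P)⁻¹` are both
algebraic integers.  (Applies to every reciprocal monic polynomial, hence to every candidate of the
small-measure census and to Lehmer's number.) -/
theorem intMahlerMeasure_unit {P : ℤ[X]} (hmonic : P.Monic) (h0 : P.coeff 0 = 1 ∨ P.coeff 0 = -1) :
    IsIntegral ℤ (intMahlerMeasure P) ∧ IsIntegral ℤ (intMahlerMeasure P)⁻¹ :=
  ⟨isIntegral_intMahlerMeasure P, isIntegral_inv_intMahlerMeasure hmonic h0⟩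

/-! ### Irreducible self-reciprocal polynomials ([McKee–Smyth, Exercise A.5]) -/

/-- **[McKee–Smyth, Exercise A.5]** An irreducible `P ∈ ℤ[X]` which is self-reciprocal
(`P.reverse = P` or `P.reverse = -P`) is `±(X - 1)`, `±(X + 1)`, or palindromic of even degree. -/
theorem self_reciprocal_irreducible_classification {P : ℤ[X]} (hirr : Irreducible P)
    (hrec : P.reverse = P ∨ P.reverse = -P) :
    (P = X - 1 ∨ P = -(X - 1)) ∨ (P = X + 1 ∨ P = -(X + 1)) ∨ (P.reverse = P ∧ Even P.natDegree) := by
  -- an irreducible polynomial divisible by `X - c` is `±(X - c)`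
  have key : ∀ t : ℤ, P.eval t = 0 → P = X - C t ∨ P = -(X - C t) := by
    intro t ht
    have hdvd : X - C t ∣ P := dvd_iff_isRoot.mpr ht
    have hass : Associated (X - C t) P := (irreducible_X_sub_C t).associated_of_dvd hirr hdvd
    obtain ⟨u, hu⟩ := hass
    obtain ⟨c, hc, hcu⟩ := Polynomial.isUnit_iff.mp u.isUnit
    rcases Int.isUnit_iff.mp hc with h | h
    · left; rw [← hu, ← hcu, h, map_one, mul_one]
    · right; rw [← hu, ← hcu, h, map_neg, map_one, mul_neg, mul_one]
  rcases hrec with hrev | hrev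
  · by_cases heven : Even P.natDegree
    · exact Or.inr (Or.inr ⟨hrev, heven⟩)
    · rw [Nat.not_even_iff_odd] at heven
      have h1 := key (-1) (eval_neg_one_eq_zero_of_reverse_eq hrev heven)
      rw [map_neg, map_one, sub_neg_eq_add] at h1
      exact Or.inr (Or.inl h1)
  · have h1 := key 1 (eval_one_eq_zero_of_reverse_eq_neg hrev)
    rw [map_one] at h1
    exact Or.inl h1

end Summit.Ventures.DiscreteObjects.Mahler
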